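import Mathlib
import Literature.Analysis.FluidPDE.Tao2016AveragedNS.ShiftSetCascadeFlows
import Summits.NavierStokesRegularity.NavierStokesRegularity.Theorems.TaoLadderRungTwoFlatRenormFrameOn
import Summits.NavierStokesRegularity.NavierStokesRegularity.Theorems.TaoLadderRungTwoFlatQuadPolarOn
import Summits.NavierStokesRegularity.NavierStokesRegularity.Theorems.TaoLadderRungTwoFlatForcedGronwall
import Summits.NavierStokesRegularity.NavierStokesRegularity.Theorems.TaoLadderRungTwoFlatRatioContinuity
import HarnessLib

/-!
# First order of the renormalised frame in the scale-ratio defect `ε₀`: the GRADING TABLE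
  (helper for item stmt-NavierStokesRegularity-22987 `FlatGapCertificatesV2`, crux K_A♭ of route
  TaoLadderRungTwoFlat; cell harvest/h2-tao-ladder, p1 g19)

In the renormalised frame (`…Theorems.RenormFrame`) the graded lattice at ratio `1+ε₀` is the homogeneous
lattice of `α̃_{ε₀}(μ) = α(μ)(1+ε₀)^{(5/2)(μ₃−μ₁−μ₂)}`. Its first-order term is the GRADING TABLE
`gradingTable α (μ) := (5/2)(μ₃ − μ₁ − μ₂)·α(μ)`:

* `hasDerivAt_renormTable_zero` — `d/dε₀ α̃_{ε₀}(μ) |_{ε₀=0} = gradingTable α μ` (entrywise);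
* `hasDerivAt_quadTermOn_renormTable_zero` — hence `d/dε₀ Q_{α̃_{ε₀}}(X) |_{0} = Q_{gradingTable α}(X)` for every
  fixed family `X` (the field is linear in the table, `QuadPolar.quadTermOn_sub_table`): the grading
  perturbation of the homogeneous field that enters the first-order (Melnikov) wake computation, whose
  `R`-oddness on the mirror table is the content of `MirrorReversibility.quadTermOn_reflectFam_graded`;
* `gradingTable_shiftSetFlat_values` — on `S♭` the factor `μ₃−μ₁−μ₂` is `0, −1, −1, 1, −2, 0, 0` on
  `(0,0,0), (1,0,0), (0,1,0), (0,0,1), (1,1,0), (1,0,1), (0,1,1)`.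

HONEST FRAMING: elementary calculus about a MODEL lattice; nothing certified; nothing about the Navier–Stokes
equations.
-/

noncomputable section

-- the sub-problem namespace repeats the summit name by design (D-0017)
set_option linter.dupNamespace false

namespace Summit.NavierStokesRegularity.NavierStokesRegularity.Theorems

open Set Filter Literature.Analysis.FluidPDE Literature.Analysis.FluidPDE.TaoCascade
open scoped Topology

namespace RenormFrame

variable {m : ℕ}

/-- The GRADING TABLE `(5/2)(μ₃ − μ₁ − μ₂)·α(μ)`: the first-order term of the renormalised table in `ε₀`.
[cite: Tao2016AveragedNS, §4 (4.8), §6.4; cell harvest/h2-tao-ladder, renormalised frame] -/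
def gradingTable (α : Fin m → Fin m → Fin m → ℤ × ℤ × ℤ → ℝ) : Fin m → Fin m → Fin m → ℤ × ℤ × ℤ → ℝ :=
  fun i₁ i₂ i₃ μ => (5 : ℝ) * (μ.2.2 - μ.1 - μ.2.1) / 2 * α i₁ i₂ i₃ μ

/-- **First order of the renormalised table**: `ε₀ ↦ α̃_{ε₀}(μ)` has derivative `gradingTable α μ` at `ε₀ = 0`.
[cite: Tao2016AveragedNS, §4 (4.8), §6.4; cell harvest/h2-tao-ladder, renormalised frame] -/
theorem hasDerivAt_renormTable_zero (α : Fin m → Fin m → Fin m → ℤ × ℤ × ℤ → ℝ) (i₁ i₂ i₃ : Fin m)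
    (μ : ℤ × ℤ × ℤ) :
    HasDerivAt (fun ε₀ : ℝ => renormTable ε₀ α i₁ i₂ i₃ μ) (gradingTable α i₁ i₂ i₃ μ) 0 := by
  have h1 : HasDerivAt (fun ε₀ : ℝ => 1 + ε₀) 1 0 := by
    simpa using (hasDerivAt_id (0 : ℝ)).const_add 1
  have h2 := h1.rpow_const (p := (5 : ℝ) * (μ.2.2 - μ.1 - μ.2.1) / 2) (Or.inl (by norm_num))
  have h3 := h2.const_mul (α i₁ i₂ i₃ μ)
  simp only [add_zero, Real.one_rpow, mul_one, one_mul] at h3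
  refine (h3.congr_deriv ?_).congr_of_eventuallyEq ?_
  · simp only [gradingTable]; ring
  · exact Filter.Eventually.of_forall fun x => by simp [renormTable]

/-- **First order of the renormalised field**: for a fixed family `X`, `ε₀ ↦ Q_{α̃_{ε₀}}(X)_{i,n}(t)` has derivative
`Q_{gradingTable α}(X)_{i,n}(t)` at `ε₀ = 0` (the grading perturbation of the homogeneous field).
[cite: Tao2016AveragedNS, §4 (4.8), §6.4; cell harvest/h2-tao-ladder, renormalised frame] -/
theorem hasDerivAt_quadTermOn_renormTable_zero (𝕊 : Finset (ℤ × ℤ × ℤ))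
    (α : Fin m → Fin m → Fin m → ℤ × ℤ × ℤ → ℝ) (X : Fin m → ℤ → ℝ → ℝ) (i : Fin m) (n : ℤ) (t : ℝ) :
    HasDerivAt (fun ε₀ : ℝ => quadTermOn 𝕊 0 (renormTable ε₀ α) X i n t)
      (quadTermOn 𝕊 0 (gradingTable α) X i n t) 0 := by
  unfold quadTermOn
  refine HasDerivAt.fun_sum fun i₁ _ => HasDerivAt.fun_sum fun i₂ _ => HasDerivAt.fun_sum fun μ _ => ?_
  have h := ((hasDerivAt_renormTable_zero α i₁ i₂ i μ).mul_const
    ((1 + (0 : ℝ)) ^ ((5 : ℝ) * (n - μ.2.2) / 2))).mul_const (X i₁ (n - μ.2.2 + μ.1) t * X i₂ (n - μ.2.2 + μ.2.1) t)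
  exact h

/-- On `S♭` the grading weights `μ₃ − μ₁ − μ₂` of the seven classes. [cite: Tao2016AveragedNS, §4 after (4.1); cell vocabulary] -/
theorem gradingTable_shiftSetFlat_values (α : Fin m → Fin m → Fin m → ℤ × ℤ × ℤ → ℝ) (i₁ i₂ i₃ : Fin m) :
    gradingTable α i₁ i₂ i₃ (0, 0, 0) = 0 ∧
      gradingTable α i₁ i₂ i₃ (1, 0, 0) = -(5 / 2) * α i₁ i₂ i₃ (1, 0, 0) ∧
      gradingTable α i₁ i₂ i₃ (0, 1, 0) = -(5 / 2) * α i₁ i₂ i₃ (0, 1, 0) ∧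
      gradingTable α i₁ i₂ i₃ (0, 0, 1) = (5 / 2) * α i₁ i₂ i₃ (0, 0, 1) ∧
      gradingTable α i₁ i₂ i₃ (1, 1, 0) = -5 * α i₁ i₂ i₃ (1, 1, 0) ∧
      gradingTable α i₁ i₂ i₃ (1, 0, 1) = 0 ∧
      gradingTable α i₁ i₂ i₃ (0, 1, 1) = 0 := by
  simp only [gradingTable]
  norm_num

/-- `‖gradingTable α‖₁ ≤ 5 ‖α‖₁` on a shell-balanced shift set (`|μ₃−μ₁−μ₂| ≤ 2`).
[cite: Tao2016AveragedNS, §4 (4.8); cell harvest/h2-tao-ladder, renormalised frame] -/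
theorem tableAbsSum_gradingTable_le {𝕊 : Finset (ℤ × ℤ × ℤ)} (h𝕊 : QuadPolar.ShiftBalance 𝕊)
    (α : Fin m → Fin m → Fin m → ℤ × ℤ × ℤ → ℝ) :
    QuadPolar.tableAbsSum 𝕊 (gradingTable α) ≤ 5 * QuadPolar.tableAbsSum 𝕊 α := by
  unfold QuadPolar.tableAbsSum
  simp only [Finset.mul_sum]
  refine Finset.sum_le_sum fun i _ => Finset.sum_le_sum fun i₁ _ => Finset.sum_le_sum fun i₂ _ =>
    Finset.sum_le_sum fun μ hμ => ?_
  have hk : (|μ.2.2 - μ.1 - μ.2.1| : ℤ) ≤ 2 := by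
    rw [Int.abs_eq_natAbs]; exact_mod_cast h𝕊 μ hμ
  have hz : |((μ.2.2 - μ.1 - μ.2.1 : ℤ) : ℝ)| ≤ 2 := by
    rw [← Int.cast_abs]; exact_mod_cast hk
  push_cast at hz
  rw [gradingTable, abs_mul, abs_div, abs_mul, abs_of_pos (by norm_num : (0 : ℝ) < 5),
    abs_of_pos (by norm_num : (0 : ℝ) < 2)]
  have ha := abs_nonneg (α i₁ i₂ i μ)
  nlinarith

end RenormFrame

end Summit.NavierStokesRegularity.NavierStokesRegularity.Theorems

end
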